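import Mathlib
import Summits.HubbardSuperconductivity.HubbardSuperconductivity.Theses.ThermalWedge
import Literature.MathematicalPhysics.QuantumLattice.FinDimSpectrumProofs
import Literature.MathematicalPhysics.QuantumLattice.ApproximatingHamiltonianProofs
import Literature.MathematicalPhysics.QuantumLattice.LiebFluxPhaseProofs

/-!
# Sketch — crux idea `sharp-sandwich-thermal-tip` for crux `ThermalWedge.TwTipContinuation`
(stmt-HubbardSuperconductivity-1700), crux-ideate round 2, ideator 5.

First lemma (`sharpSandwich`, PROVED below): for Hermitian `H`, `Y`, every `β > 0`, every real `κ`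
and EVERY normalised ground vector `ψ` of `H`,

  `κ · re⟨ψ, Y ψ⟩ ≥ F_β(H + κY) − E₀(H) = [F_β(H + κY) − F_β(H)] − D_β(H)`,

`F_β(K) := −β⁻¹ log re Z_β(K)` the free energy, `D_β(H) := E₀(H) − F_β(H) = β⁻¹ log Σₙ e^{−β(Eₙ−E₀)} ≥ 0`
the THERMAL DEPLETION of `H` (an entropy tail: `D_β = ∫_β^∞ S(b) b⁻² db`).  Variational principle for
`H + κY` at `ψ`, plus `e^{−βE₀(K)} ≤ re Z_β(K)`.  This is route ThermalWedge's entropy sandwich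
`0 ≤ e_L − f_L(β) ≤ T L⁻² log dim V` with the crude `log dim V` replaced by the true count
`log 𝒩_β = β D_β`, read at TOTAL-energy resolution with an intensive d-wave pair penalty `κ Y_L`,
`Y_L = L⁻⁴ Δ_d†Δ_d`.

Typed research stubs for THIS crux (one doping `δ` chosen BEFORE `∀ U ≤ U₁`, as the crux demands):
`TipThermalPenaltyAt` (A: thermal penalty response of the sector Gibbs state at `β_L = C·L`),
`TipDepletionAt` (B: depletion of the PURE sector Hamiltonian at `β_L` is `≤ cκ`), the window stub
`ThermalTipWindow`, and the composition target `ThermalTipWindowGivesTip`.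
-/

noncomputable section

namespace Summit.HubbardSuperconductivity.HubbardSuperconductivity.Cruxes.TwTipContinuation.SharpSandwich

open Matrix Literature.MathematicalPhysics.QuantumLattice Literature.Probability.LatticeModels
open scoped ComplexOrder MatrixOrder Classical

set_option linter.dupNamespace false

/-! ### The free energy and the thermal depletion of a finite Hermitian matrix -/

/-- Free energy `F_β(K) = −β⁻¹ log re Z_β(K)`. -/
def freeEnergy {m : Type*} [Fintype m] [DecidableEq m] (β : ℝ) (K : Matrix m m ℂ) : ℝ :=
  -(1 / β) * Real.log (partitionFn β K).re

/-- Thermal depletion `D_β(H) = E₀(H) − F_β(H) = β⁻¹ log Σₙ e^{−β(Eₙ − E₀)}` (`≥ 0`; `→ β⁻¹ log d₀`). -/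
def depletion {m : Type*} [Fintype m] [DecidableEq m] (β : ℝ) (H : Matrix m m ℂ) : ℝ :=
  H.groundEnergy - freeEnergy β H

/-! ### FL — the sharp sandwich: every ground state inherits the THERMAL penalty response minus the depletion -/

/-- **First lemma (sharp sandwich).** For Hermitian `H`, `Y` on a nonempty finite index type,
`β > 0`, real `κ`, and every normalised ground vector `ψ` of `H`:
`F_β(H + κY) − E₀(H) ≤ κ · re⟨ψ, Yψ⟩`. -/
theorem sharpSandwich {m : Type*} [Fintype m] [DecidableEq m] [Nonempty m]
    (H Y : Matrix m m ℂ) (hH : H.IsHermitian) (hY : Y.IsHermitian) {β : ℝ} (hβ : 0 < β) (κ : ℝ)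
    (ψ : m → ℂ) (hψ : star ψ ⬝ᵥ ψ = 1) (hHψ : H *ᵥ ψ = ((H.groundEnergy : ℝ) : ℂ) • ψ) :
    freeEnergy β (H + (κ : ℂ) • Y) - H.groundEnergy ≤ κ * (star ψ ⬝ᵥ Y *ᵥ ψ).re := by
  -- the penalised Hamiltonian is Hermitian
  have hκY : ((κ : ℂ) • Y).IsHermitian := by
    rw [IsHermitian, conjTranspose_smul, hY.eq]; simp
  have hK : (H + (κ : ℂ) • Y).IsHermitian := hH.add hκY
  -- Step 1 (variational): E₀(H + κY) ≤ re⟨ψ,(H+κY)ψ⟩ = E₀(H) + κ re⟨ψ,Yψ⟩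
  have hray := groundEnergy_le_rayleigh_holds hK ψ hψ
  have hKψ : star ψ ⬝ᵥ (H + (κ : ℂ) • Y) *ᵥ ψ =
      (H.groundEnergy : ℂ) + (κ : ℂ) * (star ψ ⬝ᵥ Y *ᵥ ψ) := by
    rw [Matrix.add_mulVec, Matrix.smul_mulVec, dotProduct_add, dotProduct_smul, hHψ,
      dotProduct_smul, hψ]
    simp [smul_eq_mul]
  have h1 : (H + (κ : ℂ) • Y).groundEnergy ≤ H.groundEnergy + κ * (star ψ ⬝ᵥ Y *ᵥ ψ).re := by
    have := hray
    rw [hKψ] at this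
    simpa [Complex.add_re, Complex.mul_re] using this
  -- Step 2 (entropy, one-sided): F_β(K) ≤ E₀(K), from e^{−βE₀(K)} ≤ re Z_β(K)
  have h2 := Real.log_le_log (Real.exp_pos _) (exp_neg_mul_groundEnergy_le_partitionFn hK β)
  rw [Real.log_exp] at h2
  have h3 : freeEnergy β (H + (κ : ℂ) • Y) ≤ (H + (κ : ℂ) • Y).groundEnergy := by
    unfold freeEnergy
    have hβ' : 0 < 1 / β := by positivity
    have : -(β * (H + (κ : ℂ) • Y).groundEnergy) * (1 / β) ≤
        Real.log (partitionFn β (H + (κ : ℂ) • Y)).re * (1 / β) :=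
      mul_le_mul_of_nonneg_right h2 hβ'.le
    have hs : -(β * (H + (κ : ℂ) • Y).groundEnergy) * (1 / β) = -(H + (κ : ℂ) • Y).groundEnergy := by
      field_simp
    rw [hs] at this
    linarith
  linarith

/-- **Corollary (decomposed form).** `κ re⟨ψ,Yψ⟩ ≥ [F_β(H+κY) − F_β(H)] − D_β(H)`:
thermal penalty response minus the depletion of the UNPENALISED `H`. -/
theorem sharpSandwich_decomposed {m : Type*} [Fintype m] [DecidableEq m] [Nonempty m]
    (H Y : Matrix m m ℂ) (hH : H.IsHermitian) (hY : Y.IsHermitian) {β : ℝ} (hβ : 0 < β) (κ : ℝ)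
    (ψ : m → ℂ) (hψ : star ψ ⬝ᵥ ψ = 1) (hHψ : H *ᵥ ψ = ((H.groundEnergy : ℝ) : ℂ) • ψ) :
    (freeEnergy β (H + (κ : ℂ) • Y) - freeEnergy β H) - depletion β H ≤
      κ * (star ψ ⬝ᵥ Y *ᵥ ψ).re := by
  have h := sharpSandwich H Y hH hY hβ κ ψ hψ hHψ
  unfold depletion
  linarith

/-! ### Sector objects for the crux (coordinate form of the `(N, S^z = 0)` sector; route AbelianDuality /
LogColdTorus / crux CwThesis convention) -/

/-- Occupation sets with `N` particles and `N/2` up-spins. -/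
def secPred (L N : ℕ) (s : Finset (Orb (FermionTorus 2 L))) : Prop :=
  s.card = N ∧ 2 * (s.filter fun i => (ofLex i).2 = 0).card = N

/-- The pure Hubbard torus `hubbardTorus 2 L 1 U` compressed to the sector. -/
def secH (L : ℕ) (U : ℝ) (N : ℕ) : Matrix {s // secPred L N s} {s // secPred L N s} ℂ :=
  (hubbardTorus 2 L 1 U).toBlock (secPred L N) (secPred L N)

/-- The intensive d-wave order observable `Y_L = L⁻⁴ Δ_d†Δ_d` (with `pairField = √2 Δ_d`, an
immaterial factor 2) compressed to the sector (it conserves `N`, `S^z`). -/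
def secY (L : ℕ) [NeZero L] (N : ℕ) : Matrix {s // secPred L N s} {s // secPred L N s} ℂ :=
  ((1 / ((L : ℂ) ^ 4)) • ((pairField dWaveFormFactor L)ᴴ * pairField dWaveFormFactor L)).toBlock
    (secPred L N) (secPred L N)

/-- The crux's particle number `N_L(δ) = 2⌊(1−δ)L²/2⌋`. -/
def Nd (δ : ℝ) (L : ℕ) : ℕ := 2 * ⌊(1 - δ) * (L : ℝ) ^ 2 / 2⌋₊

/-! ### Typed research stubs (the line a crux-plan would register) -/

/-- **(A) thermal penalty response at `β_L = C·L`** at the data `(U, δ, κ, c, C, L)`: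
`F_{CL}(secH + κ secY) − F_{CL}(secH) ≥ 2cκ` — suppressing the `q = 0` d-wave condensate by the
intensive penalty `κ Y_L` costs TOTAL free energy `≥ 2cκ` in the sector Gibbs state at temperature
`T_L = 1/(CL)` (below every finite-size gap scale `∼ 1/L` once `C` is large; Koma–Tasaki-consistent). -/
def TipThermalPenaltyAt (U δ κ c C : ℝ) (L : ℕ) [NeZero L] : Prop :=
  2 * c * κ ≤ freeEnergy (C * L) (secH L U (Nd δ L) + (κ : ℂ) • secY L (Nd δ L))
    - freeEnergy (C * L) (secH L U (Nd δ L))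

/-- **(B) depletion bound for the PURE torus at `β_L = C·L`**: `D_{CL}(secH) ≤ cκ`, i.e.
`Σₙ e^{−CL (Eₙ − E₀)} ≤ e^{cκCL}` in the sector — an ORDER-BLIND entropy-tail / level-count statement
(holds for a Fermi-liquid spectrum with `C ≥ √(γ/cκ)`, for a nodal superconductor with any `C`). -/
def TipDepletionAt (U δ κ c C : ℝ) (L : ℕ) [NeZero L] : Prop :=
  depletion (C * L) (secH L U (Nd δ L)) ≤ c * κ

/-- **The window stub** (quantifier shape of the crux: ONE `δ` chosen before `∀ U ≤ U₁`; all
constants may depend on `U`). -/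
def ThermalTipWindow : Prop :=
  ∃ U₁ : ℝ, 0 < U₁ ∧ ∃ δ ∈ Set.Icc (1 / 10 : ℝ) (2 / 5), ∀ U ∈ Set.Ioc (0 : ℝ) U₁,
    ∃ κ c C : ℝ, 0 < κ ∧ 0 < c ∧ 0 < C ∧ ∃ L₀ : ℕ, ∀ (L : ℕ) [NeZero L], L₀ ≤ L → Even L →
      TipThermalPenaltyAt U δ κ c C L ∧ TipDepletionAt U δ κ c C L

/-- **Composition target** (crux-plan glue; bookkeeping + `sharpSandwich_decomposed` + the landed
`twTipContinuation_iff_everyGSOrder_window` (p85630)): the window stub gives the crux, with every-GS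
order constant `c`: for every normalised sector ground state `ψ`, `c ≤ re⟨ψ, Y_L ψ⟩`. -/
def ThermalTipWindowGivesTip : Prop :=
  ThermalTipWindow →
    Summit.HubbardSuperconductivity.HubbardSuperconductivity.Theses.ThermalWedge.TwTipContinuation

end Summit.HubbardSuperconductivity.HubbardSuperconductivity.Cruxes.TwTipContinuation.SharpSandwich
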